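import Literature.IUT.LogVolume.Corollary22GaloisImage
import Literature.IUT.LogVolume.Corollary22QParamBaseChange
import Literature.IUT.LogVolume.Corollary22PartIILemmas
import Literature.NumberTheory.DiophantineGeometry.GenEllMellLocalHeight
import HarnessLib

/-!
# [IUTchIV] Cor. 2.2 (ii), step (P4) without `K_V`: `log(q^∀(λ)) ≤ deg_∞([E_F])`

S. Mochizuki, *Inter-universal Teichmüller theory IV*, RIMS manuscript (Apr. 2020; = PRIMS **57** (2021)),
proof of Cor. 2.2 (ii), p. 44 ("`h := log(q^∀) = (1/[F:ℚ])·Σ_v h_v·f_v·log(p_v)`") and step (P4) p. 45;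
S. Mochizuki, *Arithmetic elliptic curves in general position*, Math. J. Okayama Univ. **52** (2010), proof of
Lemma 3.7 p. 18 ("if `v` is any local height of `E_L`, then `d·deg_∞([E_L]) ≥ v·log(2)`").

Proof-only file (cell abc-iut, campaign S, seat abc-iut-S6). It records the COMPLETE form of the last
quotation: for a presented elliptic curve `E_F` and any finite set of finite places, `Σ_w h_w·log N(w) ≤
[F:ℚ]·deg_∞([E_F])` (`𝔇_j ⊆ ∏_w 𝔭_w^{h_w}`, the tree's `jDenominatorIdeal_le_pow_localHeight` at every `w`,
Mathlib `HeightOneSpectrum.inf_pow_eq_prod`), and its consequence for the Legendre curve `E_F` of a point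
`λ` of the `λ`-line over a theta-field (indeed any finite extension) `F ⊇ F_tpd`:
`log(q^∀(λ)) ≤ deg_∞([E_F])` (`Cor22.logQForall_le_degInf_thetaEllPoint`). This is the `K_V`-free half of
the comparison `log(q^∀) ≈ deg_∞ ≈ ht_∞` behind (P4); it lets the archimedean input of (P4) be supplied by an
explicit bound `ht_∞ ≤ κ·log(q^∀) + A` instead of a compactly bounded `K_V`
(`GenEll.exists_degInf_le_of_admitsLCyclic_of_htInf_le_linear`). Classical; no side taken on [IUTchIII]
Cor. 3.12; nothing about Theorem 1.10 is used or asserted.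
-/

noncomputable section

open scoped Classical

namespace Literature.NumberTheory.DiophantineGeometry.GenEll.EllPoint

open _root_.NumberField _root_.IsDedekindDomain Literature.IUT.LogVolume

variable (P : EllPoint)

/-- **`Σ_{w ∈ s} h_w·log N(w) ≤ [F:ℚ]·deg_∞([E])`** for every finite set `s` of finite places (`h_w` the local
height, counted as `0` where `ord_w(j) ≥ 0`): the denominator ideal `𝔇` of `j(E)` satisfies `𝔇 ⊆ 𝔭_w^{h_w}`
for every `w`, hence `𝔇 ⊆ ∏_{w∈s} 𝔭_w^{h_w}` and `N(𝔇) ≥ ∏ N(𝔭_w)^{h_w}`.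
[cite: MochizukiGenEll2010, Lem 3.7 p.18] -/
theorem sum_localHeight_mul_logNorm_le_degree_mul_degInf (s : Finset (HeightOneSpectrum (𝓞 P.F))) :
    ∑ w ∈ s, ((P.localHeight w).toNat : ℝ) * logNorm P.F w ≤ (P.degree : ℝ) * P.degInf := by
  -- `[F:ℚ]·deg_∞ = log N(𝔇)`
  have hdeg : (P.degree : ℝ) * P.degInf = Real.log (Ideal.absNorm P.W.jDenominatorIdeal) := by
    unfold EllPoint.degInf
    have hd : (P.degree : ℝ) ≠ 0 := by exact_mod_cast P.degree_pos.ne'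
    field_simp
  rw [hdeg]
  set h : HeightOneSpectrum (𝓞 P.F) → ℕ := fun w => (P.localHeight w).toNat with hh
  -- `𝔇 ≤ ∏_{w ∈ s} 𝔭_w^{h_w}`
  have hle : P.W.jDenominatorIdeal ≤ ∏ w ∈ s, w.asIdeal ^ h w := by
    have hinf := HeightOneSpectrum.inf_pow_eq_prod s h id (fun i _ j _ hij => hij)
    simp only [id] at hinf
    rw [← hinf]
    exact Finset.le_inf fun w _ => P.jDenominatorIdeal_le_pow_localHeight w
  have hdvd : Ideal.absNorm (∏ w ∈ s, w.asIdeal ^ h w) ∣ Ideal.absNorm P.W.jDenominatorIdeal :=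
    Ideal.absNorm_dvd_absNorm_of_le hle
  have hD0 : Ideal.absNorm P.W.jDenominatorIdeal ≠ 0 := by
    rw [Ne, Ideal.absNorm_eq_zero_iff]; exact P.W.jDenominatorIdeal_ne_bot
  have hleN : Ideal.absNorm (∏ w ∈ s, w.asIdeal ^ h w) ≤ Ideal.absNorm P.W.jDenominatorIdeal :=
    Nat.le_of_dvd (Nat.pos_of_ne_zero hD0) hdvd
  rw [map_prod] at hleN
  simp only [map_pow] at hleN
  -- every factor is positive
  have hpos : ∀ w ∈ s, (0 : ℝ) < (Ideal.absNorm w.asIdeal : ℝ) ^ h w := fun w _ => by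
    have h2 : 2 ≤ Ideal.absNorm w.asIdeal := NumberField.HeightOneSpectrum.one_lt_absNorm w
    have : (0 : ℝ) < Ideal.absNorm w.asIdeal := by exact_mod_cast lt_of_lt_of_le (by norm_num) h2
    positivity
  have hreal : (∏ w ∈ s, (Ideal.absNorm w.asIdeal : ℝ) ^ h w) ≤ (Ideal.absNorm P.W.jDenominatorIdeal : ℝ) := by
    exact_mod_cast hleN
  have hprodpos : (0 : ℝ) < ∏ w ∈ s, (Ideal.absNorm w.asIdeal : ℝ) ^ h w := Finset.prod_pos hpos
  calc ∑ w ∈ s, ((P.localHeight w).toNat : ℝ) * logNorm P.F w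
      = ∑ w ∈ s, Real.log ((Ideal.absNorm w.asIdeal : ℝ) ^ h w) := by
        refine Finset.sum_congr rfl fun w _ => ?_
        rw [Real.log_pow, logNorm]
    _ = Real.log (∏ w ∈ s, (Ideal.absNorm w.asIdeal : ℝ) ^ h w) :=
        (Real.log_prod (fun w hw => (hpos w hw).ne')).symm
    _ ≤ Real.log (Ideal.absNorm P.W.jDenominatorIdeal) := Real.log_le_log hprodpos hreal

end Literature.NumberTheory.DiophantineGeometry.GenEll.EllPoint

namespace Literature.IUT.LogVolume

namespace Cor22

open NumberField IsDedekindDomain Literature.NumberTheory.DiophantineGeometry.GenEll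

variable {P : NFPoint} (F : Type) [Field F] [NumberField F] [Algebra P.F F]

/-- **`log(q^∀(λ)) ≤ deg_∞([E_F])`** for the Legendre curve `E_F : y² = x(x−1)(x−λ)` over any finite extension
`F ⊇ F_tpd` ([IUTchIV] p. 44: `log(q^∀) = (1/[F:ℚ])·Σ_v h_v·f_v·log(p_v)`, the sum of the local heights;
[GenEll] Lem. 3.7 p. 18: each local height is dominated by `deg_∞`). PROVED: `log(q^∀(λ))` is independent of
the presenting field (`logQForall_of_algebraMap`), equals `(1/[F:ℚ])·Σ_{w bad} h_w·log N(w)` over `F`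
(`degree_mul_logQAvoid`), the local heights of `E_F` are those of `λ` (`thetaEllPoint_j`), and the sum is
`≤ [F:ℚ]·deg_∞` (`EllPoint.sum_localHeight_mul_logNorm_le_degree_mul_degInf`).
[cite: Mochizuki2012, IUTchIV Cor 2.2 proof p.44] [cite: MochizukiGenEll2010, Lem 3.7 p.18] -/
theorem logQForall_le_degInf_thetaEllPoint (hU : P.InU) : logQForall P ≤ (thetaEllPoint P hU F).degInf := by
  classical
  rw [← logQForall_extend P F]
  -- `[F:ℚ]·log(q^∀) = Σ_{w bad} h_w·log N(w)` over `F`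
  have hsum := degree_mul_logQAvoid (extend P F) ∅
  rw [Finset.filter_true_of_mem (fun v _ => by simp)] at hsum
  -- the local heights of `E_F` are those of `λ` over `F`
  have hloc : ∀ w : HeightOneSpectrum (𝓞 (extend P F).F),
      localHeight (extend P F) w = (((thetaEllPoint P hU F).localHeight w).toNat : ℝ) := fun w => by
    have hj := thetaEllPoint_j F hU
    unfold EllPoint.localHeight localHeight
    unfold thetaEllPoint at hj ⊢
    unfold extend
    dsimp only at hj ⊢
    rw [hj, jInv_map]
  have hd : (0 : ℝ) < (extend P F).degree := by exact_mod_cast (extend P F).degree_pos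
  have key := (thetaEllPoint P hU F).sum_localHeight_mul_logNorm_le_degree_mul_degInf (badPlaces (extend P F))
  have hsum' : ((extend P F).degree : ℝ) * logQForall (extend P F) =
      ∑ w ∈ badPlaces (extend P F), (((thetaEllPoint P hU F).localHeight w).toNat : ℝ) * logNorm (extend P F).F w := by
    unfold logQForall
    rw [hsum]
    exact Finset.sum_congr rfl fun w _ => by rw [hloc w]
  have hfin : ((extend P F).degree : ℝ) * logQForall (extend P F) ≤
      ((extend P F).degree : ℝ) * (thetaEllPoint P hU F).degInf := by
    rw [hsum']; exact key
  exact le_of_mul_le_mul_left hfin hd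

end Cor22

end Literature.IUT.LogVolume

end
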